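import Mathlib
import Literature.RepresentationTheory.FiniteGroups.CharacterDegrees
import Literature.RepresentationTheory.FiniteGroups.IrreducibleCharacters
import Literature.RepresentationTheory.FiniteGroups.InducedClassFunction
import Literature.RepresentationTheory.FiniteGroups.BrauerInduction
import Literature.RepresentationTheory.FiniteGroups.BrauerTheorem
import Literature.RepresentationTheory.FiniteGroups.MonomialRepresentation
import Summits.MatrixMultiplication.MatrixMultiplication.Theorems.SubgroupIdentityDesigns.Negative.LineStabilizer
import Summits.MatrixMultiplication.MatrixMultiplication.Theorems.SubgroupIdentityDesigns.Negative.LineStabilizerCharacter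
import Summits.MatrixMultiplication.MatrixMultiplication.Theorems.SubgroupIdentityDesigns.Negative.BlockSliceBudgetOne
import Summits.MatrixMultiplication.MatrixMultiplication.Theorems.SubgroupIdentityDesigns.Negative.PrincipalSeriesOne

/-!
# The principal-series characters `π_χ = Ind_P^G (χ ∘ a)` of `GL_n(F)`, II: irreducibility

Supports stmt-MatrixMultiplication-14079 (route `LevelGradedCohnUmans`).  VALUE = theorem, NOT summit
progress.  Continuing `PrincipalSeriesOne`: for multiplicative characters `χ, χ'` of the finite
field `F`, not both trivial,

  `⟨π_χ, π_χ'⟩ = [χ = χ']`   (`classInner_psChar`),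

hence `π_χ` is IRREDUCIBLE for `χ ≠ 1` (`isIrrChar_psChar`) and `χ ↦ π_χ` is injective on
`χ ≠ 1` (`psChar_ne`).  Proof (Mackey by hand): by Frobenius reciprocity and the fixed-line formula,
`|P| ⟨π_χ, π_χ'⟩ = ∑_{lines L} ∑_{h ∈ P_L} χ(a(h))⁻¹ χ'(b_L(h))`, where `P_L` is the stabiliser of
`L` in `P` and `b_L` the eigenvalue on `L`; the base line contributes `∑_{h ∈ P} (χ⁻¹χ')(a(h)) =
|P| [χ = χ']`, and every other line contributes the sum of the NON-TRIVIAL linear character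
`h ↦ χ(a(h))⁻¹ χ'(b_L(h))` over the group `P_L`, which vanishes (`(a, b_L) : P_L → Fˣ × Fˣ` is onto
by `2`-transitivity on independent pairs, `LineStabilizer.exists_GL_pair`).
-/

set_option linter.dupNamespace false

noncomputable section

open scoped BigOperators Matrix Classical
open Literature.RepresentationTheory.FiniteGroups

namespace Summit.MatrixMultiplication.MatrixMultiplication.Theorems.SubgroupIdentityDesigns.Negative
namespace PrincipalSeriesIrreducible

open LineStabilizer LineStabilizerCharacter PrincipalSeriesOne
open BlockSliceBudgetOne (mulVec_ne_zero)

variable {F : Type} [Field F] [Fintype F] [DecidableEq F] {n : ℕ} (i₀ : Fin n)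

local notation "Mat" => Matrix (Fin n) (Fin n) F
local notation "G₀" => GL (Fin n) F
local notation "P₀" => lineStab (F := F) i₀
local notation "Q₀" => GL (Fin n) F ⧸ lineStab (F := F) i₀
local notation "q₀" => ((1 : GL (Fin n) F) : GL (Fin n) F ⧸ lineStab (F := F) i₀)
local notation "e₀" => (Pi.single i₀ (1 : F) : Fin n → F)
/-- The vector `g e_{i₀}` spanning the line `[g] ∈ G/P` (`g = q.out`). -/
local notation "𝐯" q => (((Quotient.out q : GL (Fin n) F)) : Matrix (Fin n) (Fin n) F) *ᵥ
  (Pi.single i₀ (1 : F) : Fin n → F)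

/-! ## The eigenvalue hom `b_L` on the stabiliser of a line -/

omit [Fintype F] [DecidableEq F] in
/-- Conjugation into `P`: for `h` in the `P`-stabiliser of `[g]`, `g⁻¹ h g ∈ P`. -/
def conjHom (q : Q₀) : MulAction.stabilizer P₀ q →* P₀ where
  toFun h := ⟨(q.out : G₀)⁻¹ * ((h : P₀) : G₀) * q.out,
    (smul_eq_self_iff_mem _ ((h : P₀) : G₀) q).mp (MulAction.mem_stabilizer_iff.mp h.2)⟩
  map_one' := Subtype.ext (by simp)
  map_mul' a b := Subtype.ext (by
    simp only [Subgroup.coe_mul]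
    group)

/-- **The eigenvalue hom on the line `[g]`**: `h (g e_{i₀}) = b(h) (g e_{i₀})` for `h ∈ P_{[g]}`. -/
def bq (q : Q₀) : MulAction.stabilizer P₀ q →* Fˣ := (ev i₀).comp (conjHom i₀ q)

omit [Fintype F] [DecidableEq F] in
/-- `h v = b(h) v` on the line vector `v = g e_{i₀}`. -/
theorem mulVec_eq_bq_smul (q : Q₀) (h : MulAction.stabilizer P₀ q) :
    (((h : P₀) : G₀) : Mat) *ᵥ (𝐯 q) = ((bq i₀ q h : Fˣ) : F) • (𝐯 q) := by
  have h1 := mulVec_eq_ev_smul i₀ (conjHom i₀ q h)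
  exact (conj_mulVec_eq_iff i₀ ((h : P₀) : G₀) q.out _).mp h1

omit [Fintype F] [DecidableEq F] in
/-- Scaling both vectors of an independent pair by units keeps it independent. -/
theorem li_pair_smul {x y : Fin n → F} (h : LinearIndependent F ![x, y]) (u w : Fˣ) :
    LinearIndependent F ![(u : F) • x, (w : F) • y] := by
  rw [LinearIndependent.pair_iff] at h ⊢
  intro s t hst
  rw [smul_smul, smul_smul] at hst
  obtain ⟨hs, ht⟩ := h _ _ hst
  exact ⟨(mul_eq_zero.mp hs).resolve_right u.ne_zero, (mul_eq_zero.mp ht).resolve_right w.ne_zero⟩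

omit [Fintype F] [DecidableEq F] in
/-- For a non-base line `[g] ≠ [1]`, `(e_{i₀}, g e_{i₀})` is independent. -/
theorem li_of_ne_base {q : Q₀} (hq : q ≠ q₀) : LinearIndependent F ![e₀, 𝐯 q] := by
  refine (not_mem_lineStab_iff i₀).mp fun hmem => hq ?_
  rw [← QuotientGroup.out_eq' q]
  exact (coe_eq_base_iff i₀ q.out).mpr hmem

omit [DecidableEq F] in
/-- **`(a, b_L) : P_L → Fˣ × Fˣ` is onto** for a non-base line `L` (2-transitivity on pairs). -/
theorem exists_stab_elt {q : Q₀} (hq : q ≠ q₀) (u w : Fˣ) :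
    ∃ h : MulAction.stabilizer P₀ q, ev i₀ (h : P₀) = u ∧ bq i₀ q h = w := by
  have hv : (𝐯 q) ≠ 0 := mulVec_ne_zero q.out (single_ne_zero i₀)
  obtain ⟨g, hg1, hg2⟩ := exists_GL_pair (li_of_ne_base i₀ hq) (li_pair_smul (li_of_ne_base i₀ hq) u w)
  have hgP : g ∈ P₀ := ⟨u, hg1⟩
  have hstab : (⟨g, hgP⟩ : P₀) ∈ MulAction.stabilizer P₀ q :=
    MulAction.mem_stabilizer_iff.mpr ((smul_eq_iff_eigen i₀ ⟨g, hgP⟩ q).mpr ⟨w, hg2⟩)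
  refine ⟨⟨⟨g, hgP⟩, hstab⟩, Units.ext ?_, Units.ext ?_⟩
  · rw [coe_ev]
    exact entry_eq_of_mulVec i₀ hg1
  · have h1 := mulVec_eq_bq_smul i₀ q ⟨⟨g, hgP⟩, hstab⟩
    have h2 : (((⟨⟨g, hgP⟩, hstab⟩ : MulAction.stabilizer P₀ q) : P₀) : G₀) = g := rfl
    rw [h2, hg2] at h1
    exact (smul_left_injective F hv h1).symm

/-! ## The linear character `h ↦ χ(a(h))⁻¹ χ'(b_L(h))` of `P_L` -/

/-- The linear character `f_L(h) = χ'(b_L(h)) / χ(a(h))` of the stabiliser `P_L`. -/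
def fq (χ χ' : MulChar F ℂ) (q : Q₀) : MulAction.stabilizer P₀ q →* ℂ :=
  (Units.coeHom ℂ).comp ((χ'.toUnitHom.comp (bq i₀ q)) /
    (χ.toUnitHom.comp ((ev i₀).comp (MulAction.stabilizer P₀ q).subtype)))

omit [Fintype F] [DecidableEq F] in
/-- Value of `f_L`. -/
theorem fq_apply (χ χ' : MulChar F ℂ) (q : Q₀) (h : MulAction.stabilizer P₀ q) :
    fq i₀ χ χ' q h = (χ ((ev i₀ (h : P₀) : Fˣ) : F))⁻¹ * χ' ((bq i₀ q h : Fˣ) : F) := by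
  show (((χ'.toUnitHom (bq i₀ q h) / χ.toUnitHom (ev i₀ (h : P₀)) : ℂˣ)) : ℂ) = _
  rw [div_eq_mul_inv, Units.val_mul, Units.val_inv_eq_inv_val, MulChar.coe_toUnitHom,
    MulChar.coe_toUnitHom, mul_comm]

omit [DecidableEq F] in
/-- `f_L` is non-trivial on a non-base line unless `χ = χ' = 1`. -/
theorem fq_ne_one {χ χ' : MulChar F ℂ} (hχ : χ ≠ 1 ∨ χ' ≠ 1) {q : Q₀} (hq : q ≠ q₀) :
    fq i₀ χ χ' q ≠ 1 := by
  intro hf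
  have hval : ∀ u w : Fˣ, (χ (u : F))⁻¹ * χ' (w : F) = 1 := fun u w => by
    obtain ⟨h, hu, hw⟩ := exists_stab_elt i₀ hq u w
    have := fq_apply i₀ χ χ' q h
    rw [hf, MonoidHom.one_apply, hu, hw] at this
    exact this.symm
  rcases hχ with hχ | hχ'
  · obtain ⟨u, hu⟩ := MulChar.ne_one_iff.mp hχ
    have h1 := hval u 1
    rw [Units.val_one, map_one, mul_one, inv_eq_one] at h1
    exact hu h1
  · obtain ⟨w, hw⟩ := MulChar.ne_one_iff.mp hχ'
    by_cases hχ1 : χ = 1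
    · have h1 := hval 1 w
      rw [hχ1, MulChar.one_apply_coe, inv_one, one_mul] at h1
      exact hw h1
    · obtain ⟨u, hu⟩ := MulChar.ne_one_iff.mp hχ1
      have h1 := hval u 1
      rw [Units.val_one, map_one, mul_one, inv_eq_one] at h1
      exact hu h1

/-! ## The per-line terms of `|P| ⟨π_χ, π_χ'⟩` -/

/-- The contribution of the line `[g]` to `|P| ⟨π_χ, π_χ'⟩`. -/
def lineTerm (χ χ' : MulChar F ℂ) (q : Q₀) : ℂ :=
  ∑ h : P₀, (χ ((ev i₀ h : Fˣ) : F))⁻¹ *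
    ∑ b : F, χ' b * (if (((h : G₀)) : Mat) *ᵥ (𝐯 q) = b • (𝐯 q) then 1 else 0)

/-- `|P| ⟨π_χ, π_χ'⟩ = ∑_L lineTerm L`. -/
theorem card_mul_classInner_eq_sum (χ χ' : MulChar F ℂ) :
    (Fintype.card P₀ : ℂ) * classInner (psChar i₀ χ) (psChar i₀ χ') =
      ∑ q : Q₀, lineTerm i₀ χ χ' q := by
  rw [card_mul_classInner]
  simp only [lineTerm, psChar_eq_sum, Finset.mul_sum]
  exact Finset.sum_comm

/-- **A non-base line contributes `0`** (unless `χ = χ' = 1`): its term is the sum of the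
non-trivial linear character `f_L` over the group `P_L`. -/
theorem lineTerm_eq_zero {χ χ' : MulChar F ℂ} (hχ : χ ≠ 1 ∨ χ' ≠ 1) {q : Q₀} (hq : q ≠ q₀) :
    lineTerm i₀ χ χ' q = 0 := by
  have hv : (𝐯 q) ≠ 0 := mulVec_ne_zero q.out (single_ne_zero i₀)
  rw [lineTerm]
  -- terms with `h ∉ P_L` vanish
  rw [← Finset.sum_filter_of_ne (p := fun h : P₀ => h ∈ MulAction.stabilizer P₀ q) (fun h _ hne => ?_)]
  · rw [Finset.sum_subtype (Finset.univ.filter fun h : P₀ => h ∈ MulAction.stabilizer P₀ q)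
      (p := fun h : P₀ => h ∈ MulAction.stabilizer P₀ q) (fun h => by simp)]
    have hterm : ∀ h : MulAction.stabilizer P₀ q,
        (χ ((ev i₀ (h : P₀) : Fˣ) : F))⁻¹ * (∑ b : F, χ' b *
          (if ((((h : P₀) : G₀)) : Mat) *ᵥ (𝐯 q) = b • (𝐯 q) then 1 else 0)) = fq i₀ χ χ' q h := by
      intro h
      rw [sum_ite_eq_of_eigen ((h : P₀) : G₀) hv (mulVec_eq_bq_smul i₀ q h), fq_apply]
    rw [Finset.sum_congr rfl fun h _ => hterm h]
    exact sum_hom_units_eq_zero _ (fq_ne_one i₀ hχ hq)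
  · -- if the term is non-zero then `h` has `𝐯 q` as an eigenvector, i.e. `h ∈ P_L`
    rw [MulAction.mem_stabilizer_iff, smul_eq_iff_eigen]
    by_contra hno
    rw [sum_ite_eq_zero_of_not_eigen (h : G₀) (fun a ha => hno ⟨a, ha⟩), mul_zero] at hne
    exact hne rfl

omit [Fintype F] [DecidableEq F] in
/-- The base line vector is a multiple of `e_{i₀}`. -/
theorem base_vec : ∃ a₀ : F, (𝐯 q₀) = a₀ • e₀ := by
  obtain ⟨h, hh⟩ := QuotientGroup.mk_out_eq_mul (lineStab (F := F) i₀) (1 : G₀)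
  rw [hh, one_mul]
  exact (mem_lineStab_iff i₀).mp h.2

/-- **The base line contributes `∑_{h ∈ P} (χ⁻¹ χ')(a(h))`.** -/
theorem lineTerm_base (χ χ' : MulChar F ℂ) :
    lineTerm i₀ χ χ' q₀ = ∑ h : P₀, (χ⁻¹ * χ') ((ev i₀ h : Fˣ) : F) := by
  obtain ⟨a₀, ha₀⟩ := base_vec (F := F) i₀
  have hv : (𝐯 q₀) ≠ 0 := mulVec_ne_zero _ (single_ne_zero i₀)
  rw [lineTerm]
  refine Finset.sum_congr rfl fun h _ => ?_
  have heig : (((h : G₀)) : Mat) *ᵥ (𝐯 q₀) = ((ev i₀ h : Fˣ) : F) • (𝐯 q₀) := by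
    rw [ha₀, Matrix.mulVec_smul, mulVec_eq_ev_smul, smul_comm]
  rw [sum_ite_eq_of_eigen (h : G₀) hv heig, MulChar.mul_apply, MulChar.inv_apply_eq_inv,
    Ring.inverse_eq_inv]

/-- `∑_{h ∈ P} ψ(a(h)) = |P| [ψ = 1]` for a multiplicative character `ψ` (`a` is onto `Fˣ`). -/
theorem sum_mulChar_ev (ψ : MulChar F ℂ) :
    (∑ h : P₀, ψ ((ev i₀ h : Fˣ) : F)) = if ψ = 1 then (Fintype.card P₀ : ℂ) else 0 := by
  split_ifs with hψ
  · simp [hψ, MulChar.one_apply_coe]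
  · obtain ⟨u, hu⟩ := MulChar.ne_one_iff.mp hψ
    let f : P₀ →* ℂ := (Units.coeHom ℂ).comp (ψ.toUnitHom.comp (ev i₀))
    have hf : ∀ h, f h = ψ ((ev i₀ h : Fˣ) : F) := fun h => MulChar.coe_toUnitHom ψ _
    have hf1 : f ≠ 1 := by
      intro h1
      obtain ⟨h, hh⟩ := ev_surjective i₀ u
      have := hf h
      rw [h1, MonoidHom.one_apply, hh] at this
      exact hu this.symm
    rw [← Finset.sum_congr rfl fun h _ => hf h]
    exact sum_hom_units_eq_zero f hf1

/-! ## Orthonormality and irreducibility -/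

/-- **`⟨π_χ, π_χ'⟩ = [χ = χ']`** for `χ, χ'` not both trivial. -/
theorem classInner_psChar {χ χ' : MulChar F ℂ} (hχ : χ ≠ 1 ∨ χ' ≠ 1) :
    classInner (psChar i₀ χ) (psChar i₀ χ') = if χ = χ' then 1 else 0 := by
  have hP : (Fintype.card P₀ : ℂ) ≠ 0 := Nat.cast_ne_zero.mpr Fintype.card_ne_zero
  have h := card_mul_classInner_eq_sum i₀ χ χ'
  rw [← Finset.add_sum_erase _ _ (Finset.mem_univ q₀), Finset.sum_eq_zero
    (fun q hq => lineTerm_eq_zero i₀ hχ (Finset.ne_of_mem_erase hq)), add_zero, lineTerm_base,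
    sum_mulChar_ev] at h
  have hiff : (χ⁻¹ * χ' = 1) ↔ (χ = χ') := inv_mul_eq_one
  by_cases he : χ = χ'
  · rw [if_pos (hiff.mpr he)] at h
    rw [if_pos he]
    exact mul_left_cancel₀ hP (h.trans (mul_one _).symm)
  · rw [if_neg (fun e => he (hiff.mp e))] at h
    rw [if_neg he]
    exact (mul_eq_zero.mp h).resolve_left hP

/-- **`π_χ` is an irreducible character of `GL_n(F)` for `χ ≠ 1`.** -/
theorem isIrrChar_psChar {χ : MulChar F ℂ} (hχ : χ ≠ 1) : IsIrrChar G₀ (psChar i₀ χ) := by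
  obtain ⟨m, hm, hsum⟩ := (isCharacter_psChar (F := F) i₀ χ).exists_multiset_irrChars
  have hone : classInner m.sum m.sum = 1 := by
    rw [← hsum, classInner_psChar i₀ (Or.inl hχ), if_pos rfl]
  obtain ⟨ψ, rfl⟩ := multiset_eq_singleton hm hone
  rw [hsum, Multiset.sum_singleton]
  exact hm ψ (Multiset.mem_singleton_self ψ)

/-- **`χ ↦ π_χ` is injective on non-trivial characters.** -/
theorem psChar_ne {χ χ' : MulChar F ℂ} (hχ : χ ≠ 1) (hne : χ ≠ χ') :
    psChar i₀ χ ≠ psChar i₀ χ' := by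
  intro e
  have h1 := classInner_psChar i₀ (χ' := χ') (Or.inl hχ)
  rw [if_neg hne, ← e, classInner_psChar i₀ (Or.inl hχ), if_pos rfl] at h1
  exact one_ne_zero h1

end PrincipalSeriesIrreducible
end Summit.MatrixMultiplication.MatrixMultiplication.Theorems.SubgroupIdentityDesigns.Negative
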